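import Mathlib
import HarnessLib
import Summits.Ventures.LatticeQCDFlow.Exactness.ExactStepBoxMinorised
import Summits.Ventures.LatticeQCDFlow.Exactness.SphereFamilyCaps

/-!
# On a finite family of spheres (the `cpn_2d` phase space): an exact update dominating the product uniform law on a product of caps around every configuration, followed by ANY exact step, converges from every start

HONEST FRAMING: exact (Metropolis-corrected) sampling algorithms for lattice gauge theory;
figures of merit are autocorrelation/cost numbers at stated couplings and volumes; no
continuum-physics claim.

Venture `LatticeQCDFlow` (cell pub-lqcd), topic `Exactness`, FANOUT row 9 (eng-latcore, the engine's
`latflow.core.cpn_2d` composites: an exact update — multi-step geodesic leapfrog HMC, whose one-update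
minorant is a product of CAPS (`SphereFamilyMultiStepLeapfrogHMCErgodic.famLeapfrogHMCN_minorised_cap`,
gen-20, staged) — followed by over-relaxation / microcanonical moves (`CPNOverrelaxation.lean`, exact)).
NEW WORK of the cell over the tree (`SpreadingKernelDoeblin.lean`: a locally spreading exact kernel
interleaved with any exact Markov kernel has a Doeblin power on a compact preconnected pseudo-metric
space; `HaarBoxMinorants.lean`: `gibbsProbability_le_smul`, `smul_le_gibbsProbability`; `SphereFamilyCaps.lean`: the ball in
the product of caps, positivity of the uniform law on open sets, preconnectedness;
`SphereFamilyLeapfrog(HMC)(Ergodic).lean`: `FamS`, `FamE`, `famGibbsLaw`, `isProbabilityMeasure_famGibbsLaw`;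
`SphereCapGeometry.lean`: `sphereCap`).
Nothing is cited as a fact; no number is claimed.

THE BRIDGE for sphere families (the analogue of `ExactStepBoxMinorised.lean` for groups): the
configuration space `Π i, S^{k i + 1}` carries the sup of the chordal metrics; a product of caps of ONE
angular radius around `x` contains a metric ball of ONE radius around `x`, for every `x` (uniformity of a
compact space = neighbourhoods of the diagonal — no trigonometry); the Gibbs law `Z⁻¹e^{−S}·⊗σ` of a
bounded action is comparable to `⊗σ`, which charges every open set.  So a CAP-PRODUCT minorant
`θ • (⊗σ)|_{Π cap(x_i, r)} ≤ K x` makes `K` spread locally for the Gibbs law, and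
`spreading_comp_uniformlyErgodic` applies with ANY exact interleaved step.

* (the cap bookkeeping — `exists_ball_subset_piCap`, `isOpenPosMeasure_uniformSphere`, `preconnectedSpace_famS` — is
  `SphereFamilyCaps.lean`) **`spreads_of_piCap_minorised`**, **`exactStep_uniformlyErgodic_of_piCap_minorised`** / **`'`** — `K`
  Markov leaving `famGibbsLaw S` invariant (`|S| ≤ s`) with `θ • (⊗σ)|_{Π_i cap(x_i, r)} ≤ K x` for all `x`
  (`θ ≠ 0`, `r > 0`), `P` ANY Markov kernel leaving `famGibbsLaw S` invariant:
  `|μ₀ (P ∘ₖ K)ᵗ(A) − famGibbsLaw S (A)| ≤ (1 − ε)^{⌊t/(mm+1)⌋}` for some `mm`, `ε ∈ (0, 1]`, EVERY `μ₀`, `t`,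
  `A`, unique invariant law; the same for `K ∘ₖ P`.

NOT CLAIMED: the instance (the `cpn_2d` multi-step HMC minorant is gen-20's staged
`famLeapfrogHMCN_minorised_cap`, whose cap product `piCap x r₀` is `Set.pi univ (fun i => sphereCap (x i) r₀)`
by definition — one `exact` away once it lands); any value of `mm`, `ε`; floating point.
-/

noncomputable section

namespace Summit.Ventures.LatticeQCDFlow.Exactness

open MeasureTheory Measure Metric Set Filter Topology Function ProbabilityTheory ProbabilityTheory.Kernel
  InnerProductGeometry
open scoped ENNReal Uniformity

/-! ## Cap-product minorants spread locally; the composite converges -/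

section Composite

variable {ι : Type*} [Fintype ι] {k : ι → ℕ}

/-- **A CAP-PRODUCT MINORANT SPREADS LOCALLY FOR THE GIBBS LAW.**  If `θ • (⊗σ)|_{Π_i cap(x_i, r)} ≤ K x` for
every configuration `x` (`θ ≠ 0`, `r > 0`) and `|S| ≤ s`, then `c • (famGibbsLaw S)|_{B(x, ρ)} ≤ K x` for every
`x`, for some `ρ > 0`, `c ≠ 0`, and `famGibbsLaw S` charges every ball. -/
theorem spreads_of_piCap_minorised {K : Kernel (Π i, FamS k i) (Π i, FamS k i)} {θ : ℝ≥0∞} (hθ : θ ≠ 0) {r : ℝ}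
    (hr : 0 < r)
    (hcap : ∀ x : Π i, FamS k i,
      θ • (Measure.pi fun i => uniformSphere (volume : Measure (FamE k i))).restrict
        (Set.pi univ fun i => sphereCap (x i) r) ≤ K x)
    {S : (Π i, FamS k i) → ℝ} {s : ℝ} (hs : ∀ x, |S x| ≤ s) :
    ∃ ρ : ℝ, 0 < ρ ∧ ∃ c : ℝ≥0∞, c ≠ 0 ∧ (∀ x, c • (famGibbsLaw S).restrict (ball x ρ) ≤ K x) ∧
      ∀ (x : Π i, FamS k i) (ρ' : ℝ), 0 < ρ' → famGibbsLaw S (ball x ρ') ≠ 0 := by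
  obtain ⟨ρ, hρ, hball⟩ := exists_ball_subset_piCap (k := k) hr
  set μ : Measure (Π i, FamS k i) := Measure.pi fun i => uniformSphere (volume : Measure (FamE k i)) with hμ
  haveI : ∀ i, (uniformSphere (volume : Measure (FamE k i))).IsOpenPosMeasure := fun i => isOpenPosMeasure_uniformSphere
  have hlo : ∀ x : Π i, FamS k i, Real.exp (-s) ≤ Real.exp (-S x) := fun x =>
    Real.exp_le_exp.2 (by linarith [(abs_le.1 (hs x)).2])
  have hhi : ∀ x : Π i, FamS k i, Real.exp (-S x) ≤ Real.exp s := fun x =>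
    Real.exp_le_exp.2 (by linarith [(abs_le.1 (hs x)).1])
  have hZ := famGibbsWeight_univ_ne (k := k) hs
  set d : ℝ≥0∞ := ((μ.withDensity fun x => ENNReal.ofReal (Real.exp (-S x))) univ)⁻¹ * ENNReal.ofReal (Real.exp s) with hd
  have hd0 : d ≠ 0 := mul_ne_zero (ENNReal.inv_ne_zero.2 hZ.2) (by rw [Ne, ENNReal.ofReal_eq_zero, not_le]; exact Real.exp_pos _)
  have hdtop : d ≠ ⊤ := ENNReal.mul_ne_top (ENNReal.inv_ne_top.2 hZ.1) ENNReal.ofReal_ne_top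
  have hπle : famGibbsLaw S ≤ d • μ := by
    rw [famGibbsLaw_eq_gibbsProbability]; exact gibbsProbability_le_smul μ hhi
  refine ⟨ρ, hρ, θ * d⁻¹, mul_ne_zero hθ (ENNReal.inv_ne_zero.2 hdtop), fun x => ?_, fun x ρ' hρ' => ?_⟩
  · calc (θ * d⁻¹) • (famGibbsLaw S).restrict (ball x ρ) ≤ θ • μ.restrict (ball x ρ) := by
          rw [← smul_smul]
          refine Measure.le_iff.2 fun E hE => ?_
          simp only [Measure.smul_apply, smul_eq_mul, Measure.restrict_apply hE]
          refine mul_le_mul' le_rfl ?_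
          calc d⁻¹ * famGibbsLaw S (E ∩ ball x ρ) ≤ d⁻¹ * (d * μ (E ∩ ball x ρ)) := by
                refine mul_le_mul' le_rfl ?_
                have h := Measure.le_iff'.1 hπle (E ∩ ball x ρ)
                rwa [Measure.smul_apply, smul_eq_mul] at h
            _ = μ (E ∩ ball x ρ) := by rw [← mul_assoc, ENNReal.inv_mul_cancel hd0 hdtop, one_mul]
      _ ≤ θ • μ.restrict (Set.pi univ fun i => sphereCap (x i) r) := by
          refine Measure.le_iff'.2 fun E => ?_
          simp only [Measure.smul_apply, smul_eq_mul]
          refine mul_le_mul' le_rfl (Measure.le_iff'.1 (Measure.restrict_mono (fun y hy => ?_) le_rfl) E)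
          exact mem_univ_pi.2 fun i => mem_sphereCap.2 (hball x y (mem_ball.1 hy) i)
      _ ≤ K x := hcap x
  · have hlow : (((μ.withDensity fun x => ENNReal.ofReal (Real.exp (-S x))) univ)⁻¹ * ENNReal.ofReal (Real.exp (-s))) • μ ≤
        famGibbsLaw S := by
      rw [famGibbsLaw_eq_gibbsProbability]; exact smul_le_gibbsProbability μ hlo
    have h := Measure.le_iff'.1 hlow (ball x ρ')
    rw [Measure.smul_apply, smul_eq_mul] at h
    refine fun h0 => ?_
    rw [h0, nonpos_iff_eq_zero, mul_eq_zero] at h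
    rcases h with h | h
    · exact mul_ne_zero (ENNReal.inv_ne_zero.2 hZ.2) (by rw [Ne, ENNReal.ofReal_eq_zero, not_le]; exact Real.exp_pos _) h
    · exact (isOpen_ball.measure_ne_zero μ ⟨x, mem_ball_self hρ'⟩) h

/-- **A CAP-MINORISED EXACT UPDATE ON A SPHERE FAMILY FOLLOWED BY ANY EXACT STEP CONVERGES FROM EVERY START, AT
EVERY TIME, AND HAS THE GIBBS LAW AS ITS ONLY INVARIANT LAW.**  `K` Markov, leaving `famGibbsLaw S` invariant
(`|S| ≤ s`), with `θ • (⊗σ)|_{Π_i cap(x_i, r)} ≤ K x` for every `x` (`θ ≠ 0`, `r > 0`); `P` ANY Markov kernel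
leaving `famGibbsLaw S` invariant.  Then `|μ₀ (P ∘ₖ K)ᵗ(A) − famGibbsLaw S (A)| ≤ (1 − ε)^{⌊t/(mm+1)⌋}` for some
`mm`, `ε ∈ (0, 1]`, EVERY initial law `μ₀`, every `t`, every `A`; unique invariant probability law. -/
theorem exactStep_uniformlyErgodic_of_piCap_minorised {K : Kernel (Π i, FamS k i) (Π i, FamS k i)} [IsMarkovKernel K]
    {S : (Π i, FamS k i) → ℝ} {s : ℝ} (hs : ∀ x, |S x| ≤ s) (hKinv : Invariant K (famGibbsLaw S))
    {θ : ℝ≥0∞} (hθ : θ ≠ 0) {r : ℝ} (hr : 0 < r)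
    (hcap : ∀ x : Π i, FamS k i,
      θ • (Measure.pi fun i => uniformSphere (volume : Measure (FamE k i))).restrict
        (Set.pi univ fun i => sphereCap (x i) r) ≤ K x)
    (P : Kernel (Π i, FamS k i) (Π i, FamS k i)) [IsMarkovKernel P] (hP : Invariant P (famGibbsLaw S)) :
    ∃ mm : ℕ, ∃ ε : ℝ, 0 < ε ∧ ε ≤ 1 ∧
      (∀ (μ₀ : Measure (Π i, FamS k i)) [IsProbabilityMeasure μ₀] (t : ℕ) (A : Set (Π i, FamS k i)),
        |((fun ν : Measure (Π i, FamS k i) => ν.bind (P ∘ₖ K))^[t] μ₀).real A - (famGibbsLaw S).real A| ≤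
          (1 - ε) ^ (t / (mm + 1))) ∧
      ∀ (π' : Measure (Π i, FamS k i)) [IsProbabilityMeasure π'], Invariant (P ∘ₖ K) π' → π' = famGibbsLaw S := by
  haveI := preconnectedSpace_famS (k := k)
  haveI := isProbabilityMeasure_famGibbsLaw (k := k) hs
  obtain ⟨ρ, hρ, c, hc, hK, hpos⟩ := spreads_of_piCap_minorised hθ hr hcap hs
  exact spreading_comp_uniformlyErgodic hKinv hP hρ hc hK hpos

/-- **ANY EXACT STEP FOLLOWED BY THE CAP-MINORISED UPDATE CONVERGES FROM EVERY START TOO** (`K ∘ₖ P`). -/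
theorem exactStep_uniformlyErgodic_of_piCap_minorised' {K : Kernel (Π i, FamS k i) (Π i, FamS k i)} [IsMarkovKernel K]
    {S : (Π i, FamS k i) → ℝ} {s : ℝ} (hs : ∀ x, |S x| ≤ s) (hKinv : Invariant K (famGibbsLaw S))
    {θ : ℝ≥0∞} (hθ : θ ≠ 0) {r : ℝ} (hr : 0 < r)
    (hcap : ∀ x : Π i, FamS k i,
      θ • (Measure.pi fun i => uniformSphere (volume : Measure (FamE k i))).restrict
        (Set.pi univ fun i => sphereCap (x i) r) ≤ K x)
    (P : Kernel (Π i, FamS k i) (Π i, FamS k i)) [IsMarkovKernel P] (hP : Invariant P (famGibbsLaw S)) :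
    ∃ mm : ℕ, ∃ ε : ℝ, 0 < ε ∧ ε ≤ 1 ∧
      (∀ (μ₀ : Measure (Π i, FamS k i)) [IsProbabilityMeasure μ₀] (t : ℕ) (A : Set (Π i, FamS k i)),
        |((fun ν : Measure (Π i, FamS k i) => ν.bind (K ∘ₖ P))^[t] μ₀).real A - (famGibbsLaw S).real A| ≤
          (1 - ε) ^ (t / (mm + 1))) ∧
      ∀ (π' : Measure (Π i, FamS k i)) [IsProbabilityMeasure π'], Invariant (K ∘ₖ P) π' → π' = famGibbsLaw S := by
  haveI := preconnectedSpace_famS (k := k)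
  haveI := isProbabilityMeasure_famGibbsLaw (k := k) hs
  obtain ⟨ρ, hρ, c, hc, hK, hpos⟩ := spreads_of_piCap_minorised hθ hr hcap hs
  exact spreading_comp_uniformlyErgodic' hKinv hP hρ hc hK hpos

end Composite

end Summit.Ventures.LatticeQCDFlow.Exactness
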